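import Mathlib
import Literature.NumberTheory.LFunctions.ConnesProlateGuess
import Literature.NumberTheory.LFunctions.ProlateFrobenius
import Literature.NumberTheory.LFunctions.ProlateShooting
import HarnessLib

/-!
# Prolate functions from the principal Frobenius solution

THIS IS NOT AN RH STATEMENT.  Let `u_χ = frobSol λ χ` be the principal solution of the prolate equation
(normalised by `u_χ(λ) = 1`).  We record that it is an `IsProlateODESol` on `(−λ, 3λ)`, that its zeros
in `(−λ, λ)` are simple and finitely many in `[0, λ]`, and the **even extension**: if `u_b′(0) = 0` and
`u_b` has `k` zeros in `(0, λ)`, then `u_b` is even on `(−λ, λ)` (Cauchy uniqueness against the reflected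
solution) and `x ↦ C·u_b(|x|)·𝟙_{|x| ≤ λ}` (suitably normalised) is an `IsProlateFunction λ (2k)`.
This reduces the existence half of `existsUnique_isProlateFunction` to finding, for each `k`, a
parameter `b` with `u_b′(0) = 0` and exactly `k` zeros — the shooting argument of the sequel.

References: [Coddington–Levinson 1955, Ch. 8 §2]; [Slepian–Pollak 1961, §III];
[Connes–Consani–Moscovici 2025, §7 (7.9)–(7.12)].
-/

noncomputable section

open Real Set Filter Topology MeasureTheory

namespace Literature.NumberTheory.LFunctions

variable {lam : ℝ}

/-- Membership in `(−λ, 3λ)` is the convergence condition `|λ − x| < 2λ`. [folklore] -/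
theorem mem_Ioo_three_iff {x : ℝ} : x ∈ Ioo (-lam) (3 * lam) ↔ |lam - x| < 2 * lam := by
  rw [abs_sub_lt_iff, mem_Ioo]
  constructor <;> rintro ⟨h1, h2⟩ <;> constructor <;> linarith

/-- `[0, λ] ⊆ (−λ, 3λ)`. [folklore] -/
theorem Icc_subset_Ioo_three (hlam : 0 < lam) : Icc 0 lam ⊆ Ioo (-lam) (3 * lam) :=
  fun _ hx ↦ ⟨by linarith [hx.1], by linarith [hx.2]⟩

/-- `(−λ, λ) ⊆ (−λ, 3λ)`. [folklore] -/
theorem Ioo_subset_Ioo_three (hlam : 0 < lam) : Ioo (-lam) lam ⊆ Ioo (-lam) (3 * lam) :=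
  Ioo_subset_Ioo le_rfl (by linarith)

/-- The principal Frobenius solution solves the prolate equation on `(−λ, 3λ)`.
[cite: CoddingtonLevinson1955, Ch. 4 §8; ConnesConsaniMoscovici2025, §7 eq. (7.5)] -/
theorem isProlateODESol_frobSol (hlam : 0 < lam) (χ : ℝ) :
    IsProlateODESol lam χ (Ioo (-lam) (3 * lam)) (frobSol lam χ) (frobSol₁ lam χ)
      (frobSol₂ lam χ) :=
  ⟨fun _ hx ↦ hasDerivAt_frobSol hlam χ (mem_Ioo_three_iff.mp hx),
    fun _ hx ↦ hasDerivAt_frobSol₁ hlam χ (mem_Ioo_three_iff.mp hx),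
    fun _ hx ↦ frobSol_ode hlam χ (mem_Ioo_three_iff.mp hx)⟩

/-- `u_χ` is continuous on `[0, λ]`. [folklore] -/
theorem continuousOn_frobSol_Icc (hlam : 0 < lam) (χ : ℝ) :
    ContinuousOn (frobSol lam χ) (Icc 0 lam) := fun _ hx ↦
  (hasDerivAt_frobSol hlam χ
    (mem_Ioo_three_iff.mp (Icc_subset_Ioo_three hlam hx))).continuousAt.continuousWithinAt

/-- Zeros of `u_χ` in `(−λ, λ)` are simple (since `u_χ(λ) = 1 ≠ 0`).
[cite: CoddingtonLevinson1955, Ch. 8 §1] -/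
theorem frobSol₁_ne_zero_of_zero (hlam : 0 < lam) (χ : ℝ) {x : ℝ} (hx : x ∈ Ioo (-lam) lam)
    (h0 : frobSol lam χ x = 0) : frobSol₁ lam χ x ≠ 0 := by
  have hl : |lam - lam| < 2 * lam := by simp; linarith
  exact (isProlateODESol_frobSol hlam χ).deriv_ne_zero_of_zero hlam (Ioo_subset_Ioo_three hlam)
    (hasDerivAt_frobSol hlam χ hl).continuousAt.continuousWithinAt
    (by rw [frobSol_self]; exact one_ne_zero) hx h0

/-- `u_χ` has finitely many zeros in `[0, λ]`. [cite: CoddingtonLevinson1955, Ch. 8 §1] -/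
theorem finite_zeros_frobSol_Icc (hlam : 0 < lam) (χ : ℝ) :
    {x | x ∈ Icc 0 lam ∧ frobSol lam χ x = 0}.Finite := by
  refine finite_zeros_of_deriv_ne_zero (u₁ := frobSol₁ lam χ) (continuousOn_frobSol_Icc hlam χ)
    fun x hx h0 ↦ ?_
  have hxl : x < lam := lt_of_le_of_ne hx.2 fun h ↦ by
    rw [h, frobSol_self] at h0; exact one_ne_zero h0
  exact ⟨hasDerivAt_frobSol hlam χ (mem_Ioo_three_iff.mp (Icc_subset_Ioo_three hlam hx)),
    frobSol₁_ne_zero_of_zero hlam χ ⟨by linarith [hx.1], hxl⟩ h0⟩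

/-- `u_χ` has finitely many zeros in `(0, λ)`. [cite: CoddingtonLevinson1955, Ch. 8 §1] -/
theorem finite_zeros_frobSol (hlam : 0 < lam) (χ : ℝ) :
    {x | x ∈ Ioo 0 lam ∧ frobSol lam χ x = 0}.Finite :=
  (finite_zeros_frobSol_Icc hlam χ).subset fun _ hx ↦ ⟨Ioo_subset_Icc_self hx.1, hx.2⟩

/-- Sums of solutions are solutions. [folklore] -/
theorem IsProlateODESol.add {χ : ℝ} {S : Set ℝ} {u u₁ u₂ v v₁ v₂ : ℝ → ℝ}
    (hu : IsProlateODESol lam χ S u u₁ u₂) (hv : IsProlateODESol lam χ S v v₁ v₂) :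
    IsProlateODESol lam χ S (fun x ↦ u x + v x) (fun x ↦ u₁ x + v₁ x) (fun x ↦ u₂ x + v₂ x) :=
  ⟨fun x hx ↦ (hu.hasDerivAt x hx).add (hv.hasDerivAt x hx),
    fun x hx ↦ (hu.hasDerivAt₁ x hx).add (hv.hasDerivAt₁ x hx),
    fun x hx ↦ by linear_combination hu.ode x hx + hv.ode x hx⟩

/-- The reflection `x ↦ u(−x)` of a solution on `(−λ, 3λ)` is a solution on `(−λ, λ)` (the equation is
even). [folklore] -/
theorem IsProlateODESol.reflect {χ : ℝ} {u u₁ u₂ : ℝ → ℝ}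
    (hu : IsProlateODESol lam χ (Ioo (-lam) (3 * lam)) u u₁ u₂) :
    IsProlateODESol lam χ (Ioo (-lam) lam) (fun x ↦ u (-x)) (fun x ↦ -u₁ (-x))
      (fun x ↦ u₂ (-x)) := by
  have hmem : ∀ x ∈ Ioo (-lam) lam, -x ∈ Ioo (-lam) (3 * lam) :=
    fun x hx ↦ ⟨by linarith [hx.2], by linarith [hx.1, hx.2]⟩
  have hn : ∀ x : ℝ, HasDerivAt (fun y : ℝ ↦ -y) (-1) x := fun x ↦ hasDerivAt_neg' x
  refine ⟨fun x hx ↦ ?_, fun x hx ↦ ?_, fun x hx ↦ ?_⟩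
  · exact ((hu.hasDerivAt (-x) (hmem x hx)).comp x (hn x)).congr_deriv (by ring)
  · exact ((hu.hasDerivAt₁ (-x) (hmem x hx)).comp x (hn x)).neg.congr_deriv (by ring)
  · linear_combination hu.ode (-x) (hmem x hx)

/-- **Evenness.**  If `u_b′(0) = 0` then `u_b(−x) = u_b(x)` on `(−λ, λ)`.
[cite: CoddingtonLevinson1955, Ch. 1 §3 Thm 3.1; ConnesConsaniMoscovici2025, §7 (7.11)] -/
theorem frobSol_neg_eq (hlam : 0 < lam) {b : ℝ} (hB : frobSol₁ lam b 0 = 0) {x : ℝ}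
    (hx : x ∈ Ioo (-lam) lam) : frobSol lam b (-x) = frobSol lam b x := by
  have hu := isProlateODESol_frobSol hlam b
  have hw := hu.reflect.add (hu.neg.mono (Ioo_subset_Ioo_three hlam))
  have h0 : (0 : ℝ) ∈ Ioo (-lam) lam := ⟨by linarith, hlam⟩
  have hz := hw.eq_zero_of_double_zero hlam Subset.rfl h0 (by simp) (by simp [hB]) x hx
  linarith

/-- `∫₀^λ u_χ² > 0`. [folklore] -/
theorem integral_frobSol_sq_pos (hlam : 0 < lam) (χ : ℝ) :
    0 < ∫ x in (0 : ℝ)..lam, frobSol lam χ x ^ 2 := by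
  have hcont := continuousOn_frobSol_Icc hlam χ
  have hcl : ContinuousWithinAt (frobSol lam χ) (Icc 0 lam) lam := hcont lam ⟨hlam.le, le_rfl⟩
  obtain ⟨δ₀, hδ₀, hδ₀'⟩ := Metric.continuousWithinAt_iff.mp hcl (1 / 2) (by norm_num)
  set δ := min (δ₀ / 2) lam with hδ
  have hδpos : 0 < δ := by rw [hδ]; positivity
  have hδlam : δ ≤ lam := min_le_right _ _
  have hδδ₀ : δ < δ₀ := lt_of_le_of_lt (min_le_left _ _) (by linarith)
  have hhalf : ∀ y ∈ Icc (lam - δ) lam, 1 / 2 < frobSol lam χ y := by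
    intro y hy
    have h1 := hδ₀' (x := y) ⟨by linarith [hy.1], hy.2⟩
      (by rw [Real.dist_eq, abs_lt]; constructor <;> linarith [hy.1, hy.2])
    rw [frobSol_self, Real.dist_eq, abs_lt] at h1
    linarith [h1.1]
  have hsq : ContinuousOn (fun x ↦ frobSol lam χ x ^ 2) (Icc 0 lam) := hcont.pow 2
  have hi1 : IntervalIntegrable (fun x ↦ frobSol lam χ x ^ 2) volume 0 (lam - δ) :=
    (hsq.mono (Icc_subset_Icc le_rfl (by linarith))).intervalIntegrable_of_Icc (by linarith)
  have hi2 : IntervalIntegrable (fun x ↦ frobSol lam χ x ^ 2) volume (lam - δ) lam :=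
    (hsq.mono (Icc_subset_Icc (by linarith) le_rfl)).intervalIntegrable_of_Icc (by linarith)
  rw [← intervalIntegral.integral_add_adjacent_intervals hi1 hi2]
  have h1 : 0 ≤ ∫ x in (0 : ℝ)..(lam - δ), frobSol lam χ x ^ 2 :=
    intervalIntegral.integral_nonneg (by linarith) fun _ _ ↦ sq_nonneg _
  have h2 : 0 < ∫ x in (lam - δ)..lam, frobSol lam χ x ^ 2 := by
    refine intervalIntegral.intervalIntegral_pos_of_pos_on hi2 (fun x hx ↦ ?_) (by linarith)
    have := hhalf x (Ioo_subset_Icc_self hx)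
    positivity
  linarith

/-- **Even extension.**  If `u_b′(0) = 0` and `u_b` has `k` zeros in `(0, λ)`, then a normalised multiple of
`x ↦ u_b(|x|)·𝟙_{|x| ≤ λ}` is a prolate function with `2k` zeros.
[cite: SlepianPollak1961, §III; ConnesConsaniMoscovici2025, §7 (7.9)–(7.12)] -/
theorem exists_isProlateFunction_of_frobSol (hlam : 0 < lam) {b : ℝ} {k : ℕ}
    (hB : frobSol₁ lam b 0 = 0) (hN : {x | x ∈ Ioo 0 lam ∧ frobSol lam b x = 0}.ncard = k) :
    ∃ f, IsProlateFunction lam (2 * k) f := by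
  have h0mem : (0 : ℝ) ∈ Ioo (-lam) lam := ⟨by linarith, hlam⟩
  have hA : frobSol lam b 0 ≠ 0 := fun h ↦ frobSol₁_ne_zero_of_zero hlam b h0mem h hB
  have heven := fun x (hx : x ∈ Ioo (-lam) lam) ↦ frobSol_neg_eq hlam hB hx
  have hcont := continuousOn_frobSol_Icc hlam b
  have hsol := isProlateODESol_frobSol hlam b
  -- normalisation constants
  set I := ∫ x in (0 : ℝ)..lam, frobSol lam b x ^ 2 with hI
  have hIpos : 0 < I := integral_frobSol_sq_pos hlam b
  set s : ℝ := if 0 < frobSol lam b 0 then 1 else -1 with hs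
  have hs1 : s ^ 2 = 1 := by rw [hs]; split_ifs <;> norm_num
  have hsA : 0 < s * frobSol lam b 0 := by
    rw [hs]; split_ifs with h
    · simpa using h
    · have : frobSol lam b 0 < 0 := lt_of_le_of_ne (not_lt.mp h) hA
      linarith
  set C : ℝ := s / Real.sqrt (2 * I) with hC
  have hsqrt : 0 < Real.sqrt (2 * I) := Real.sqrt_pos.mpr (by positivity)
  have hC2 : C ^ 2 * (2 * I) = 1 := by
    rw [hC, div_pow, hs1, Real.sq_sqrt (by positivity)]
    field_simp
  have hC0 : C ≠ 0 := by
    intro h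
    rw [h] at hC2
    simp at hC2
  -- the function
  set f : ℝ → ℝ := fun x ↦ if |x| ≤ lam then C * frobSol lam b |x| else 0 with hf
  have hfIoc : ∀ x ∈ Ioc (-lam) lam, f x = C * frobSol lam b x := by
    intro x hx
    have hxabs : |x| ≤ lam := abs_le.mpr ⟨hx.1.le, hx.2⟩
    simp only [hf, if_pos hxabs]
    rcases le_or_gt 0 x with h | h
    · rw [abs_of_nonneg h]
    · rw [abs_of_neg h, heven x ⟨hx.1, by linarith⟩]
  have hfIco : ∀ x ∈ Ico (-lam) lam, f x = C * frobSol lam b (-x) := by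
    intro x hx
    have hxabs : |x| ≤ lam := abs_le.mpr ⟨hx.1, hx.2.le⟩
    simp only [hf, if_pos hxabs]
    rcases le_or_gt 0 x with h | h
    · rw [abs_of_nonneg h, heven x ⟨by linarith, hx.2⟩]
    · rw [abs_of_neg h]
  have hfIoo : ∀ x ∈ Ioo (-lam) lam, f x = C * frobSol lam b x :=
    fun x hx ↦ hfIoc x ⟨hx.1, hx.2.le⟩
  have hfev : ∀ x ∈ Ioo (-lam) lam, f =ᶠ[𝓝 x] fun y ↦ C * frobSol lam b y := by
    intro x hx
    filter_upwards [Ioo_mem_nhds hx.1 hx.2] with y hy using hfIoo y hy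
  -- the zero set
  set Z := {x | x ∈ Ioo 0 lam ∧ frobSol lam b x = 0} with hZ
  have hZfin : Z.Finite := finite_zeros_frobSol hlam b
  have hZf : {x : ℝ | x ∈ Ioo (-lam) lam ∧ f x = 0} = Z ∪ (fun x ↦ -x) '' Z := by
    ext x
    simp only [mem_setOf_eq, mem_union, mem_image]
    constructor
    · rintro ⟨hx, hfx⟩
      rw [hfIoo x hx, mul_eq_zero] at hfx
      have hux := hfx.resolve_left hC0
      rcases lt_trichotomy x 0 with h | h | h
      · refine Or.inr ⟨-x, ⟨⟨by linarith, by linarith [hx.1]⟩, ?_⟩, neg_neg x⟩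
        rwa [heven x hx]
      · exact absurd (h ▸ hux) hA
      · exact Or.inl ⟨⟨h, hx.2⟩, hux⟩
    · rintro (⟨hx, hux⟩ | ⟨y, ⟨hy, huy⟩, rfl⟩)
      · have hx' : x ∈ Ioo (-lam) lam := ⟨by linarith [hx.1], hx.2⟩
        exact ⟨hx', by rw [hfIoo x hx', hux, mul_zero]⟩
      · have hy' : -y ∈ Ioo (-lam) lam := ⟨by linarith [hy.2], by linarith [hy.1]⟩
        refine ⟨hy', ?_⟩
        rw [hfIoo (-y) hy', heven y ⟨by linarith [hy.1], hy.2⟩, huy, mul_zero]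
  refine ⟨f, hlam, ?_, ?_, ?_, ?_, ?_, ?_, ?_⟩
  · -- C² on [−λ, λ]
    intro x hx
    by_cases hxl : x < lam
    · -- use the reflected branch near `x`
      have hg : ContDiffAt ℝ 2 (fun y ↦ C * frobSol lam b (-y)) x := by
        have h1 : ContDiffAt ℝ 2 (frobSol lam b) (-x) :=
          (contDiffOn_frobSol hlam b).contDiffAt
            (Ioo_mem_nhds (by linarith [hx.2]) (by linarith [hx.1]))
        exact contDiffAt_const.mul (h1.comp x contDiffAt_id.neg)
      refine hg.contDiffWithinAt.congr_of_eventuallyEq ?_ (hfIco x ⟨hx.1, hxl⟩)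
      filter_upwards [nhdsWithin_le_nhds (Iio_mem_nhds hxl), self_mem_nhdsWithin] with y hy1 hy2
        using hfIco y ⟨hy2.1, hy1⟩
    · have hxl' : -lam < x := by linarith [not_lt.mp hxl]
      have hg : ContDiffAt ℝ 2 (fun y ↦ C * frobSol lam b y) x :=
        contDiffAt_const.mul ((contDiffOn_frobSol hlam b).contDiffAt
          (Ioo_mem_nhds hxl' (by linarith [hx.2])))
      refine hg.contDiffWithinAt.congr_of_eventuallyEq ?_ (hfIoc x ⟨hxl', hx.2⟩)
      filter_upwards [nhdsWithin_le_nhds (Ioi_mem_nhds hxl'), self_mem_nhdsWithin] with y hy1 hy2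
        using hfIoc y ⟨hy1, hy2.2⟩
  · -- the eigen-equation with `χ = b`
    refine ⟨b, fun x hx ↦ ?_⟩
    have hd1 : ∀ y ∈ Ioo (-lam) lam, deriv f y = C * frobSol₁ lam b y := by
      intro y hy
      rw [(hfev y hy).deriv_eq]
      exact ((hsol.hasDerivAt y (Ioo_subset_Ioo_three hlam hy)).const_mul C).deriv
    have hflux : deriv (fun y ↦ (lam ^ 2 - y ^ 2) * deriv f y) x =
        C * (((2 * π * lam * x) ^ 2 - b) * frobSol lam b x) := by
      have hev : (fun y ↦ (lam ^ 2 - y ^ 2) * deriv f y) =ᶠ[𝓝 x]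
          fun y ↦ C * ((lam ^ 2 - y ^ 2) * frobSol₁ lam b y) := by
        filter_upwards [Ioo_mem_nhds hx.1 hx.2] with y hy
        rw [hd1 y hy]; ring
      rw [hev.deriv_eq]
      exact ((hsol.hasDerivAt_flux (Ioo_subset_Ioo_three hlam hx)).const_mul C).deriv
    rw [hflux, hfIoo x hx]
    ring
  · -- support
    intro x hx
    simp only [hf, if_neg (not_le.mpr hx)]
  · rw [hZf]; exact hZfin.union (hZfin.image _)
  · rw [hZf, ncard_union_eq ?_ hZfin (hZfin.image _), ncard_image_of_injective _ neg_injective, hN]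
    · ring
    · exact disjoint_left.mpr fun x hx ⟨y, hy, hxy⟩ ↦ by
        have := hy.1.1; have := hx.1.1; rw [← hxy] at this; linarith
  · -- normalisation
    have hcongr : EqOn (fun x ↦ f x ^ 2) (fun x ↦ C ^ 2 * frobSol lam b |x| ^ 2)
        (uIcc (-lam) lam) := by
      intro x hx
      rw [uIcc_of_le (by linarith)] at hx
      have hxabs : |x| ≤ lam := abs_le.mpr ⟨hx.1, hx.2⟩
      simp only [hf, if_pos hxabs]
      ring
    rw [intervalIntegral.integral_congr hcongr, intervalIntegral.integral_const_mul]
    have habs : ContinuousOn (fun x ↦ frobSol lam b |x| ^ 2) (Icc (-lam) lam) := by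
      refine (hcont.comp continuous_abs.continuousOn fun x hx ↦ ?_).pow 2
      exact ⟨abs_nonneg x, abs_le.mpr ⟨hx.1, hx.2⟩⟩
    have hi1 : IntervalIntegrable (fun x ↦ frobSol lam b |x| ^ 2) volume (-lam) 0 :=
      (habs.mono (Icc_subset_Icc le_rfl hlam.le)).intervalIntegrable_of_Icc (by linarith)
    have hi2 : IntervalIntegrable (fun x ↦ frobSol lam b |x| ^ 2) volume 0 lam :=
      (habs.mono (Icc_subset_Icc (by linarith) le_rfl)).intervalIntegrable_of_Icc hlam.le
    rw [← intervalIntegral.integral_add_adjacent_intervals hi1 hi2]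
    have hleft : ∫ x in (-lam)..0, frobSol lam b |x| ^ 2 = I := by
      have hc : EqOn (fun x ↦ frobSol lam b |x| ^ 2) (fun x ↦ frobSol lam b (-x) ^ 2)
          (uIcc (-lam) 0) := by
        intro x hx
        rw [uIcc_of_le (by linarith)] at hx
        simp only [abs_of_nonpos hx.2]
      rw [intervalIntegral.integral_congr hc,
        intervalIntegral.integral_comp_neg (fun x ↦ frobSol lam b x ^ 2)]
      simp [hI]
    have hright : ∫ x in (0 : ℝ)..lam, frobSol lam b |x| ^ 2 = I := by
      have hc : EqOn (fun x ↦ frobSol lam b |x| ^ 2) (fun x ↦ frobSol lam b x ^ 2)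
          (uIcc 0 lam) := by
        intro x hx
        rw [uIcc_of_le hlam.le] at hx
        simp only [abs_of_nonneg hx.1]
      rw [intervalIntegral.integral_congr hc]
    rw [hleft, hright]
    linear_combination hC2
  · -- positivity at `0`
    have : f 0 = s * frobSol lam b 0 / Real.sqrt (2 * I) := by
      simp only [hf, abs_zero, if_pos hlam.le, hC]
      ring
    rw [this]
    exact div_pos hsA hsqrt

end Literature.NumberTheory.LFunctions
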